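import Summits.KontsevichZagierPeriods.KontsevichZagierPeriods.Theorems.SoloBlindZetaBoxChart
import HarnessLib

/-!
# Three charts for Beukers' `ζ(3)`-integral

Geometric input for `SoloBlindZetaThree`, where Beukers' representation
`I₀ = [(0,1)³, 1/(1-(1-xy)w)]` of `2ζ(3)` is moved onto two copies of the box `B₃` of `ζ(3)`.
Coordinates on `ℝ³` are `v = (v₀, v₁, v₂) = (x, y, t)`.  The cells

* `W = {v ∈ (0,1)³ | xy < t}` (`beukersWedge`), `U = {v ∈ (0,1)³ | x < t}` (`upperWedge`),
* `U' = {v ∈ (0,1)³ | y < t}` (`sideWedge`), `D = {v ∈ (0,1)³ | xy < t < x}` (`lowerWedge`),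

and the three `ℚ`-polynomial charts

* `Φ(x,y,w) = (x, y, 1-(1-xy)w) : (0,1)³ → W`, Jacobian `1 - xy` (`beukersChart`);
* `Ψ(s,y,t) = (ts, y, t) : (0,1)³ → U`, Jacobian `t` (`mulChart`);
* `Θ(x,y,t') = (x, y, xt') : U' → D`, Jacobian `x` (`scaleChart`):

each shown semialgebraic, differentiable, injective, with the stated image and Jacobian.
-/

noncomputable section

namespace Summit.KontsevichZagierPeriods.KontsevichZagierPeriods.Theorems

open Set MeasureTheory
open Literature.ModelTheory.ExponentialFields (IsSemialgebraic isSemialgebraic_setOf_eval_pos)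
open MvPolynomial (aeval X)
open Literature.NumberTheory.Transcendental
open Literature.NumberTheory.Transcendental.KZ

namespace SoloBlind

/-- The coordinate projections of `ℝ³`, as continuous linear maps. -/
abbrev prj (i : Fin 3) : (Fin 3 → ℝ) →L[ℝ] ℝ :=
  ContinuousLinearMap.proj (R := ℝ) (φ := fun _ : Fin 3 => ℝ) i

/-! ## The cells -/

/-- `W = {v ∈ (0,1)³ | v₀v₁ < v₂}`. -/
def beukersWedge : Set (Fin 3 → ℝ) := kzOpenBox 3 ∩ {v | v 0 * v 1 < v 2}

/-- `U = {v ∈ (0,1)³ | v₀ < v₂}`. -/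
def upperWedge : Set (Fin 3 → ℝ) := kzOpenBox 3 ∩ {v | v 0 < v 2}

/-- `U' = {v ∈ (0,1)³ | v₁ < v₂}`. -/
def sideWedge : Set (Fin 3 → ℝ) := kzOpenBox 3 ∩ {v | v 1 < v 2}

/-- `D = {v ∈ (0,1)³ | v₀v₁ < v₂ < v₀}`. -/
def lowerWedge : Set (Fin 3 → ℝ) := kzOpenBox 3 ∩ {v | v 0 * v 1 < v 2 ∧ v 2 < v 0}

/-- `W` is `ℚ`-semialgebraic. -/
theorem isSemialgebraic_beukersWedge : IsSemialgebraic ℚ beukersWedge := by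
  have h : {v : Fin 3 → ℝ | v 0 * v 1 < v 2} =
      {v | 0 < aeval v (X 2 - X 0 * X 1 : MvPolynomial (Fin 3) ℚ)} := by
    ext v; simp [sub_pos]
  rw [beukersWedge, h]
  exact (isSemialgebraic_kzOpenBox 3).inter (isSemialgebraic_setOf_eval_pos _)

/-- `U` is `ℚ`-semialgebraic. -/
theorem isSemialgebraic_upperWedge : IsSemialgebraic ℚ upperWedge := by
  have h : {v : Fin 3 → ℝ | v 0 < v 2} =
      {v | 0 < aeval v (X 2 - X 0 : MvPolynomial (Fin 3) ℚ)} := by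
    ext v; simp [sub_pos]
  rw [upperWedge, h]
  exact (isSemialgebraic_kzOpenBox 3).inter (isSemialgebraic_setOf_eval_pos _)

/-- `U'` is `ℚ`-semialgebraic. -/
theorem isSemialgebraic_sideWedge : IsSemialgebraic ℚ sideWedge := by
  have h : {v : Fin 3 → ℝ | v 1 < v 2} =
      {v | 0 < aeval v (X 2 - X 1 : MvPolynomial (Fin 3) ℚ)} := by
    ext v; simp [sub_pos]
  rw [sideWedge, h]
  exact (isSemialgebraic_kzOpenBox 3).inter (isSemialgebraic_setOf_eval_pos _)

/-- `D` is `ℚ`-semialgebraic. -/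
theorem isSemialgebraic_lowerWedge : IsSemialgebraic ℚ lowerWedge := by
  have h : {v : Fin 3 → ℝ | v 0 * v 1 < v 2 ∧ v 2 < v 0} =
      {v | 0 < aeval v (X 2 - X 0 * X 1 : MvPolynomial (Fin 3) ℚ)} ∩
        {v | 0 < aeval v (X 0 - X 2 : MvPolynomial (Fin 3) ℚ)} := by
    ext v; simp [sub_pos]
  rw [lowerWedge, h]
  exact (isSemialgebraic_kzOpenBox 3).inter
    ((isSemialgebraic_setOf_eval_pos _).inter (isSemialgebraic_setOf_eval_pos _))

/-- `U'` is measurable. -/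
theorem measurableSet_sideWedge : MeasurableSet sideWedge :=
  IsSemialgebraic.measurableSet_holds isSemialgebraic_sideWedge

/-- Membership in the box `(0,1)³`, coordinatewise. -/
theorem mem_kzOpenBox_three {v : Fin 3 → ℝ} :
    v ∈ kzOpenBox 3 ↔ v 0 ∈ Ioo 0 1 ∧ v 1 ∈ Ioo 0 1 ∧ v 2 ∈ Ioo 0 1 :=
  ⟨fun h => ⟨h 0, h 1, h 2⟩, fun h i => by
    fin_cases i
    · exact h.1
    · exact h.2.1
    · exact h.2.2⟩

/-! ## `Ψ(s,y,t) = (ts, y, t)` -/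

/-- The chart `Ψ(v) = (v₂v₀, v₁, v₂)`. -/
def mulChart (w : Fin 3 → ℝ) : Fin 3 → ℝ := ![w 2 * w 0, w 1, w 2]

/-- The rows of `DΨ(w)`. -/
def mulRow (w : Fin 3 → ℝ) : Fin 3 → ((Fin 3 → ℝ) →L[ℝ] ℝ) :=
  ![w 2 • prj 0 + w 0 • prj 2, prj 1, prj 2]

/-- `DΨ(w)`. -/
def mulDeriv (w : Fin 3 → ℝ) : (Fin 3 → ℝ) →L[ℝ] (Fin 3 → ℝ) := ContinuousLinearMap.pi (mulRow w)

/-- `Ψ` is differentiable with derivative `mulDeriv`. -/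
theorem hasFDerivAt_mulChart (w : Fin 3 → ℝ) : HasFDerivAt mulChart (mulDeriv w) w := by
  rw [hasFDerivAt_pi']
  intro i
  have hrow : (prj i).comp (mulDeriv w) = mulRow w i := ContinuousLinearMap.ext fun v => by
    simp [mulDeriv]
  rw [hrow]
  fin_cases i
  · have h : HasFDerivAt (fun y : Fin 3 → ℝ => y 2 * y 0) (w 2 • prj 0 + w 0 • prj 2) w :=
      (hasFDerivAt_apply (2 : Fin 3) w).mul (hasFDerivAt_apply (0 : Fin 3) w)
    simpa [mulRow, mulChart] using h
  · simpa [mulRow, mulChart] using hasFDerivAt_apply (1 : Fin 3) w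
  · simpa [mulRow, mulChart] using hasFDerivAt_apply (2 : Fin 3) w

/-- The matrix of `DΨ(w)`. -/
theorem toMatrix_mulDeriv (w : Fin 3 → ℝ) :
    LinearMap.toMatrix' ((mulDeriv w : (Fin 3 → ℝ) →L[ℝ] (Fin 3 → ℝ)) :
      (Fin 3 → ℝ) →ₗ[ℝ] (Fin 3 → ℝ)) = !![w 2, 0, w 0; 0, 1, 0; 0, 0, 1] := by
  ext i j
  rw [LinearMap.toMatrix'_apply, ContinuousLinearMap.coe_coe]
  fin_cases i <;> fin_cases j <;> simp [mulDeriv, mulRow]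

/-- `det DΨ(w) = w₂`. -/
theorem det_mulDeriv (w : Fin 3 → ℝ) : (mulDeriv w).det = w 2 := by
  rw [ContinuousLinearMap.det, ← LinearMap.det_toMatrix', toMatrix_mulDeriv, Matrix.det_fin_three]
  simp

/-- On the box, `|det DΨ(w)| = w₂`. -/
theorem abs_det_mulDeriv {w : Fin 3 → ℝ} (hw : w ∈ kzOpenBox 3) : |(mulDeriv w).det| = w 2 := by
  rw [det_mulDeriv]
  exact abs_of_pos (hw 2).1

/-- `Ψ` is injective on the box. -/
theorem injOn_mulChart : InjOn mulChart (kzOpenBox 3) := by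
  intro a ha b hb h
  have h0 : a 2 * a 0 = b 2 * b 0 := congrFun h 0
  have h1 : a 1 = b 1 := congrFun h 1
  have h2 : a 2 = b 2 := congrFun h 2
  rw [h2] at h0
  have ha0 := mul_left_cancel₀ (hb 2).1.ne' h0
  funext i
  fin_cases i
  · exact ha0
  · exact h1
  · exact h2

/-- `Ψ` maps the box onto `U`. -/
theorem image_mulChart : mulChart '' kzOpenBox 3 = upperWedge := by
  refine Subset.antisymm (image_subset_iff.mpr fun w hw => ?_) fun v hv => ?_
  · obtain ⟨h0, h1, h2⟩ := mem_kzOpenBox_three.mp hw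
    refine ⟨mem_kzOpenBox_three.mpr ⟨⟨?_, ?_⟩, h1, h2⟩, ?_⟩
    · show 0 < w 2 * w 0; nlinarith [h0.1, h2.1]
    · show w 2 * w 0 < 1; nlinarith [h0.1, h0.2, h2.1, h2.2]
    · show w 2 * w 0 < w 2; nlinarith [h0.2, h2.1]
  · obtain ⟨h0, h1, h2⟩ := mem_kzOpenBox_three.mp hv.1
    have hlt : v 0 < v 2 := hv.2
    refine ⟨![v 0 / v 2, v 1, v 2],
      mem_kzOpenBox_three.mpr ⟨⟨div_pos h0.1 h2.1, (div_lt_one h2.1).mpr hlt⟩, h1, h2⟩, ?_⟩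
    funext i
    fin_cases i
    · show v 2 * (v 0 / v 2) = v 0; exact mul_div_cancel₀ (v 0) h2.1.ne'
    · rfl
    · rfl

/-- `Ψ` is a `ℚ`-polynomial, hence `ℚ`-semialgebraic, map. -/
theorem isSemialgebraicMapOn_mulChart : IsSemialgebraicMapOn ℚ (kzOpenBox 3) mulChart := by
  refine IsSemialgebraicMapOn.of_forall (isSemialgebraic_kzOpenBox 3) fun i => ?_
  fin_cases i
  · exact (isSemialgebraicFunOn_aeval (isSemialgebraic_kzOpenBox 3) (X 2 * X 0)).congr
      fun w _ => by simp [mulChart]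
  · exact (isSemialgebraicFunOn_aeval (isSemialgebraic_kzOpenBox 3) (X 1)).congr
      fun w _ => by simp [mulChart]
  · exact (isSemialgebraicFunOn_aeval (isSemialgebraic_kzOpenBox 3) (X 2)).congr
      fun w _ => by simp [mulChart]

/-! ## `Θ(x,y,t') = (x, y, xt')` -/

/-- The chart `Θ(v) = (v₀, v₁, v₀v₂)`. -/
def scaleChart (w : Fin 3 → ℝ) : Fin 3 → ℝ := ![w 0, w 1, w 0 * w 2]

/-- The rows of `DΘ(w)`. -/
def scaleRow (w : Fin 3 → ℝ) : Fin 3 → ((Fin 3 → ℝ) →L[ℝ] ℝ) :=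
  ![prj 0, prj 1, w 0 • prj 2 + w 2 • prj 0]

/-- `DΘ(w)`. -/
def scaleDeriv (w : Fin 3 → ℝ) : (Fin 3 → ℝ) →L[ℝ] (Fin 3 → ℝ) :=
  ContinuousLinearMap.pi (scaleRow w)

/-- `Θ` is differentiable with derivative `scaleDeriv`. -/
theorem hasFDerivAt_scaleChart (w : Fin 3 → ℝ) : HasFDerivAt scaleChart (scaleDeriv w) w := by
  rw [hasFDerivAt_pi']
  intro i
  have hrow : (prj i).comp (scaleDeriv w) = scaleRow w i := ContinuousLinearMap.ext fun v => by
    simp [scaleDeriv]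
  rw [hrow]
  fin_cases i
  · simpa [scaleRow, scaleChart] using hasFDerivAt_apply (0 : Fin 3) w
  · simpa [scaleRow, scaleChart] using hasFDerivAt_apply (1 : Fin 3) w
  · have h : HasFDerivAt (fun y : Fin 3 → ℝ => y 0 * y 2) (w 0 • prj 2 + w 2 • prj 0) w :=
      (hasFDerivAt_apply (0 : Fin 3) w).mul (hasFDerivAt_apply (2 : Fin 3) w)
    simpa [scaleRow, scaleChart] using h

/-- The matrix of `DΘ(w)`. -/
theorem toMatrix_scaleDeriv (w : Fin 3 → ℝ) :
    LinearMap.toMatrix' ((scaleDeriv w : (Fin 3 → ℝ) →L[ℝ] (Fin 3 → ℝ)) :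
      (Fin 3 → ℝ) →ₗ[ℝ] (Fin 3 → ℝ)) = !![1, 0, 0; 0, 1, 0; w 2, 0, w 0] := by
  ext i j
  rw [LinearMap.toMatrix'_apply, ContinuousLinearMap.coe_coe]
  fin_cases i <;> fin_cases j <;> simp [scaleDeriv, scaleRow]

/-- `det DΘ(w) = w₀`. -/
theorem det_scaleDeriv (w : Fin 3 → ℝ) : (scaleDeriv w).det = w 0 := by
  rw [ContinuousLinearMap.det, ← LinearMap.det_toMatrix', toMatrix_scaleDeriv,
    Matrix.det_fin_three]
  simp

/-- On `U'`, `|det DΘ(w)| = w₀`. -/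
theorem abs_det_scaleDeriv {w : Fin 3 → ℝ} (hw : w ∈ sideWedge) :
    |(scaleDeriv w).det| = w 0 := by
  rw [det_scaleDeriv]
  exact abs_of_pos (hw.1 0).1

/-- `Θ` is injective on `U'`. -/
theorem injOn_scaleChart : InjOn scaleChart sideWedge := by
  intro a ha b hb h
  have h0 : a 0 = b 0 := congrFun h 0
  have h1 : a 1 = b 1 := congrFun h 1
  have h2 : a 0 * a 2 = b 0 * b 2 := congrFun h 2
  rw [h0] at h2
  have ha2 := mul_left_cancel₀ (hb.1 0).1.ne' h2
  funext i
  fin_cases i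
  · exact h0
  · exact h1
  · exact ha2

/-- `Θ` maps `U'` onto `D`. -/
theorem image_scaleChart : scaleChart '' sideWedge = lowerWedge := by
  refine Subset.antisymm (image_subset_iff.mpr fun w hw => ?_) fun v hv => ?_
  · obtain ⟨h0, h1, h2⟩ := mem_kzOpenBox_three.mp hw.1
    have hlt : w 1 < w 2 := hw.2
    refine ⟨mem_kzOpenBox_three.mpr ⟨h0, h1, ?_, ?_⟩, ?_, ?_⟩
    · show 0 < w 0 * w 2; nlinarith [h0.1, h2.1]
    · show w 0 * w 2 < 1; nlinarith [h0.1, h0.2, h2.1, h2.2]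
    · show w 0 * w 1 < w 0 * w 2; nlinarith [h0.1]
    · show w 0 * w 2 < w 0; nlinarith [h0.1, h2.2]
  · obtain ⟨h0, h1, h2⟩ := mem_kzOpenBox_three.mp hv.1
    obtain ⟨hlt, hlt'⟩ := hv.2
    have h3 : v 1 < v 2 / v 0 := by rw [lt_div_iff₀ h0.1]; linarith
    refine ⟨![v 0, v 1, v 2 / v 0], ⟨mem_kzOpenBox_three.mpr
      ⟨h0, h1, div_pos h2.1 h0.1, (div_lt_one h0.1).mpr hlt'⟩, h3⟩, ?_⟩
    funext i
    fin_cases i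
    · rfl
    · rfl
    · show v 0 * (v 2 / v 0) = v 2; exact mul_div_cancel₀ (v 2) h0.1.ne'

/-- `Θ` is a `ℚ`-polynomial, hence `ℚ`-semialgebraic, map on `U'`. -/
theorem isSemialgebraicMapOn_scaleChart : IsSemialgebraicMapOn ℚ sideWedge scaleChart := by
  refine IsSemialgebraicMapOn.of_forall isSemialgebraic_sideWedge fun i => ?_
  fin_cases i
  · exact (isSemialgebraicFunOn_aeval isSemialgebraic_sideWedge (X 0)).congr
      fun w _ => by simp [scaleChart]
  · exact (isSemialgebraicFunOn_aeval isSemialgebraic_sideWedge (X 1)).congr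
      fun w _ => by simp [scaleChart]
  · exact (isSemialgebraicFunOn_aeval isSemialgebraic_sideWedge (X 0 * X 2)).congr
      fun w _ => by simp [scaleChart]

/-! ## `Φ(x,y,w) = (x, y, 1 - (1-xy)w)` -/

/-- Beukers' chart `Φ(v) = (v₀, v₁, 1 - (1 - v₀v₁)v₂)`. -/
def beukersChart (w : Fin 3 → ℝ) : Fin 3 → ℝ := ![w 0, w 1, 1 - (1 - w 0 * w 1) * w 2]

/-- The rows of `DΦ(w)`. -/
def beukersRow (w : Fin 3 → ℝ) : Fin 3 → ((Fin 3 → ℝ) →L[ℝ] ℝ) :=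
  ![prj 0, prj 1, (w 1 * w 2) • prj 0 + (w 0 * w 2) • prj 1 + (-(1 - w 0 * w 1)) • prj 2]

/-- `DΦ(w)`. -/
def beukersDeriv (w : Fin 3 → ℝ) : (Fin 3 → ℝ) →L[ℝ] (Fin 3 → ℝ) :=
  ContinuousLinearMap.pi (beukersRow w)

/-- `Φ` is differentiable with derivative `beukersDeriv`. -/
theorem hasFDerivAt_beukersChart (w : Fin 3 → ℝ) :
    HasFDerivAt beukersChart (beukersDeriv w) w := by
  rw [hasFDerivAt_pi']
  intro i
  have hrow : (prj i).comp (beukersDeriv w) = beukersRow w i :=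
    ContinuousLinearMap.ext fun v => by simp [beukersDeriv]
  rw [hrow]
  fin_cases i
  · simpa [beukersRow, beukersChart] using hasFDerivAt_apply (0 : Fin 3) w
  · simpa [beukersRow, beukersChart] using hasFDerivAt_apply (1 : Fin 3) w
  · have h : HasFDerivAt (fun v : Fin 3 → ℝ => 1 - (1 - v 0 * v 1) * v 2)
        ((0 : (Fin 3 → ℝ) →L[ℝ] ℝ) - ((1 - w 0 * w 1) • prj 2 +
          w 2 • ((0 : (Fin 3 → ℝ) →L[ℝ] ℝ) - (w 0 • prj 1 + w 1 • prj 0)))) w :=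
      (hasFDerivAt_const (1 : ℝ) w).sub
        (((hasFDerivAt_const (1 : ℝ) w).sub
          ((hasFDerivAt_apply (0 : Fin 3) w).mul (hasFDerivAt_apply (1 : Fin 3) w))).mul
          (hasFDerivAt_apply (2 : Fin 3) w))
    refine (h.congr_fderiv (ContinuousLinearMap.ext fun v => ?_)).congr_of_eventuallyEq
      (Filter.Eventually.of_forall fun v => by simp [beukersChart])
    simp [beukersRow]
    ring

/-- The matrix of `DΦ(w)`. -/
theorem toMatrix_beukersDeriv (w : Fin 3 → ℝ) :
    LinearMap.toMatrix' ((beukersDeriv w : (Fin 3 → ℝ) →L[ℝ] (Fin 3 → ℝ)) :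
      (Fin 3 → ℝ) →ₗ[ℝ] (Fin 3 → ℝ)) =
      !![1, 0, 0; 0, 1, 0; w 1 * w 2, w 0 * w 2, -(1 - w 0 * w 1)] := by
  ext i j
  rw [LinearMap.toMatrix'_apply, ContinuousLinearMap.coe_coe]
  fin_cases i <;> fin_cases j <;> simp [beukersDeriv, beukersRow]

/-- `det DΦ(w) = -(1 - w₀w₁)`. -/
theorem det_beukersDeriv (w : Fin 3 → ℝ) : (beukersDeriv w).det = -(1 - w 0 * w 1) := by
  rw [ContinuousLinearMap.det, ← LinearMap.det_toMatrix', toMatrix_beukersDeriv,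
    Matrix.det_fin_three]
  simp

/-- On the box, `xy < 1`. -/
theorem mul_lt_one_of_mem_kzOpenBox {w : Fin 3 → ℝ} (hw : w ∈ kzOpenBox 3) : w 0 * w 1 < 1 := by
  have h0 := hw 0
  have h1 := hw 1
  simp only [mem_Ioo] at h0 h1
  nlinarith

/-- On the box, `|det DΦ(w)| = 1 - w₀w₁`. -/
theorem abs_det_beukersDeriv {w : Fin 3 → ℝ} (hw : w ∈ kzOpenBox 3) :
    |(beukersDeriv w).det| = 1 - w 0 * w 1 := by
  rw [det_beukersDeriv, abs_neg]
  exact abs_of_pos (by linarith [mul_lt_one_of_mem_kzOpenBox hw])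

/-- `Φ` is injective on the box. -/
theorem injOn_beukersChart : InjOn beukersChart (kzOpenBox 3) := by
  intro a ha b hb h
  have h0 : a 0 = b 0 := congrFun h 0
  have h1 : a 1 = b 1 := congrFun h 1
  have h2 : 1 - (1 - a 0 * a 1) * a 2 = 1 - (1 - b 0 * b 1) * b 2 := congrFun h 2
  rw [h0, h1] at h2
  have hne : 1 - b 0 * b 1 ≠ 0 := by linarith [mul_lt_one_of_mem_kzOpenBox hb]
  have ha2 : a 2 = b 2 := mul_left_cancel₀ hne (by linarith)
  funext i
  fin_cases i
  · exact h0
  · exact h1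
  · exact ha2

/-- `Φ` maps the box onto `W`. -/
theorem image_beukersChart : beukersChart '' kzOpenBox 3 = beukersWedge := by
  refine Subset.antisymm (image_subset_iff.mpr fun w hw => ?_) fun v hv => ?_
  · have hxy := mul_lt_one_of_mem_kzOpenBox hw
    obtain ⟨h0, h1, h2⟩ := mem_kzOpenBox_three.mp hw
    have hp : 0 < (1 - w 0 * w 1) * w 2 := mul_pos (by linarith) h2.1
    have hq : (1 - w 0 * w 1) * w 2 < 1 - w 0 * w 1 := mul_lt_of_lt_one_right (by linarith) h2.2
    have hxy0 : 0 < w 0 * w 1 := mul_pos h0.1 h1.1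
    refine ⟨mem_kzOpenBox_three.mpr ⟨h0, h1, ?_, ?_⟩, ?_⟩
    · show 0 < 1 - (1 - w 0 * w 1) * w 2; linarith
    · show 1 - (1 - w 0 * w 1) * w 2 < 1; linarith
    · show w 0 * w 1 < 1 - (1 - w 0 * w 1) * w 2; linarith
  · have hxy := mul_lt_one_of_mem_kzOpenBox hv.1
    obtain ⟨h0, h1, h2⟩ := mem_kzOpenBox_three.mp hv.1
    have hlt : v 0 * v 1 < v 2 := hv.2
    have hd : 0 < 1 - v 0 * v 1 := by linarith
    have h3 : (1 - v 2) / (1 - v 0 * v 1) < 1 := by rw [div_lt_one hd]; linarith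
    refine ⟨![v 0, v 1, (1 - v 2) / (1 - v 0 * v 1)],
      mem_kzOpenBox_three.mpr ⟨h0, h1, div_pos (by linarith [h2.2]) hd, h3⟩, ?_⟩
    funext i
    fin_cases i
    · rfl
    · rfl
    · show 1 - (1 - v 0 * v 1) * ((1 - v 2) / (1 - v 0 * v 1)) = v 2
      field_simp
      ring

/-- `Φ` is a `ℚ`-polynomial, hence `ℚ`-semialgebraic, map. -/
theorem isSemialgebraicMapOn_beukersChart : IsSemialgebraicMapOn ℚ (kzOpenBox 3) beukersChart := by
  refine IsSemialgebraicMapOn.of_forall (isSemialgebraic_kzOpenBox 3) fun i => ?_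
  fin_cases i
  · exact (isSemialgebraicFunOn_aeval (isSemialgebraic_kzOpenBox 3) (X 0)).congr
      fun w _ => by simp [beukersChart]
  · exact (isSemialgebraicFunOn_aeval (isSemialgebraic_kzOpenBox 3) (X 1)).congr
      fun w _ => by simp [beukersChart]
  · exact (isSemialgebraicFunOn_aeval (isSemialgebraic_kzOpenBox 3)
      (1 - (1 - X 0 * X 1) * X 2)).congr fun w _ => by simp [beukersChart]

end SoloBlind

end Summit.KontsevichZagierPeriods.KontsevichZagierPeriods.Theorems
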